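import Literature.AlgebraicGeometry.Frobenioids.PadicKummerRemark242Witness
import Literature.AlgebraicGeometry.Frobenioids.PadicKummerRemark221
import Literature.NumberTheory.GaloisRepresentations.LocalFieldFiniteExtensionIntegers
import Literature.NumberTheory.LocalFields.UnitsPrimePowerBijective
import HarnessLib

/-!
# Frobenioids II, Remark 2.4.2 at the arithmetic context: the unit-wise Frobenius witness is
# NON-VACUOUS — `O^×_L` has bijective `ℓ`-th power, so Theorem 2.4 (ii)'s compatibility fails

Proof-only companion (abc-iut cell, layer L1, seat abc-iut-w5-d248 gen 2; SUBDAG-FrdII-Thm24 row L26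
`UnitwiseFrobeniusWitness`, residue (r2) of `PadicKummerRemark242Witness.lean` p418148) to
abc-iut-L1-t7's `PadicKummerLocalField.lean` (the zero-parameter ARITHMETIC context
`Def22Context.ofLocalField L H hH S` with `O^□(A) := O^□_L`).

S. Mochizuki, *The geometry of Frobenioids II*, Kyushu J. Math. **62** (2008), Remark 2.4.2 p. 22
[cite: MochizukiFrdII2008, Rmk 2.4.2 p.22]: "if the `Φᵢ` are not fieldwise saturated, then the
natural isomorphisms `F_N(Aᵢ) ⥲ ℤ/Nℤ` are not, in general, compatible with the isomorphism
`F_N(A₁) ⥲ F_N(A₂)` induced by `Ψ`. For instance, when the `Φᵢ` are absolutely primitive [so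
`O^□ = O^×`, Def. 2.2 (iii)], an example of such a `Ψ` is provided by the unit-wise Frobenius
functor … which acts on `F_N(Aᵢ)` … by raising to the `ζ`-th power."

What is PROVED here (classical local algebra + transport; `K` a non-archimedean local field,
`L ⊆ K̄` a finite extension, `O^×_L` = abc-iut-L4-t2's `unitSubmonoid K L` = the units of the
integral closure of `𝒪_K` in `L`):
* `mem_unitSubmonoid_iff_valuation_eq_one` — `O^×_L` is the unit group of the ring of integers of
  `L` for the prolonged valuation (tree: `FiniteExtension.valuation_eq_one_iff_isIntegral_and_isIntegral_inv`,
  Serre *Local Fields* II §2 Prop. 3);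
* `GalMonoid.pow_bijective_of_units_pow_bijective` / `GalMonoid.exists_prime_pow_bijective_and_natCast_eq`
  (with `GalMonoid.val_pow` of `PadicKummerRemark221.lean`)
  — transport of `Literature.NumberTheory.LocalFields.pow_units_bijective_of_card_lt` (every prime
  `ℓ > #𝓀_L` acts bijectively on `𝒪_L^×`, Neukirch *ANT* II (5.7)) to the monoid `O^×_L` of the
  context, with `ℓ` in any prescribed unit class mod `N` (Dirichlet);
* **`Def22Context.rmk242_witness_ofLocalField`** — for `N > 2` and EVERY additive isomorphism
  `inv : F_N(A) ⥲ ℤ/Nℤ` of the arithmetic context with `O^□ = O^×_L`, there is an automorphism of the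
  Definition 2.2 data (identity on `Aut_E(A_E)`; the `ℓ`-th power on `O^×_L`, `ℓ ≡ −1 (mod N)`) whose
  CONSTRUCTED comparison data (`Def22Context.Iso.thm24Data`) are `InvariantIncompatible`; hence the
  conclusion of Theorem 2.4 (ii) fails for them (`rmk242_not_compatible_ofLocalField`).

Honest framing: the automorphism is the shadow on ONE object's Definition 2.2 data of the unit-wise
Frobenius functor of [FrdI] Prop. 2.9 (ii) (tree: `PreFrobenioid.unitWiseFrobeniusZetaExists`); the
category→context binding is not done here (abc-iut-L1-t7 (α)). No new definitions; nothing here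
concerns [IUTchIII].
-/

namespace Literature.AlgebraicGeometry.Frobenioids

namespace PadicKummer

open ValuativeRel
open Literature.NumberTheory.GaloisRepresentations
open Literature.NumberTheory.LocalFields
open Literature.AnabelianGeometry.AbsoluteAnabelian (unitSubmonoid)

variable {K : Type} [Field K] [ValuativeRel K] [TopologicalSpace K] [IsNonarchimedeanLocalField K]
  (L : IntermediateField K (AlgebraicClosure K)) [FiniteDimensional K L]

/-! ### `O^×_L` is the unit group of the ring of integers of `L` -/

/-- `O^×_L` (the units of the integral closure of `𝒪_K` in `L`, [AbsTopIII] Def. 3.1 (i) /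
[FrdII] Def. 2.2 (iii)) consists exactly of the elements of valuation `1` for the valuation of `L`
prolonging that of `K` (Serre, *Local Fields* II §2 Prop. 3). [cite: MochizukiFrdII2008, Def 2.2 (iii) p.18] -/
theorem mem_unitSubmonoid_iff_valuation_eq_one (x : L) :
    x ∈ unitSubmonoid K L ↔ (letI := FiniteExtension.valuativeRel K L; valuation L x = 1) := by
  letI := FiniteExtension.valuativeRel K L
  constructor
  · rintro ⟨hx, y, hy, hxy⟩
    have hx0 : x ≠ 0 := fun h => by
      rw [h, zero_mul] at hxy
      exact zero_ne_one hxy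
    rw [FiniteExtension.valuation_eq_one_iff_isIntegral_and_isIntegral_inv K L hx0]
    have hyinv : x⁻¹ = y := (eq_inv_of_mul_eq_one_right hxy).symm
    exact ⟨(mem_integralClosure_iff _ _).mp hx, hyinv ▸ (mem_integralClosure_iff _ _).mp hy⟩
  · intro h
    have hx0 : x ≠ 0 := by
      intro h0
      rw [h0, map_zero] at h
      exact zero_ne_one h
    rw [FiniteExtension.valuation_eq_one_iff_isIntegral_and_isIntegral_inv K L hx0] at h
    exact ⟨(mem_integralClosure_iff _ _).mpr h.1, x⁻¹, (mem_integralClosure_iff _ _).mpr h.2,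
      mul_inv_cancel₀ hx0⟩

/-- An element of `O^×_L` lies in the ring of integers `𝒪_L` of the prolonged valuation.
[cite: MochizukiFrdII2008, Def 2.2 (iii) p.18] -/
theorem mem_integer_of_mem_unitSubmonoid {x : L} (hx : x ∈ unitSubmonoid K L) :
    letI := FiniteExtension.valuativeRel K L; x ∈ 𝒪[L] := by
  letI := FiniteExtension.valuativeRel K L
  rw [Valuation.mem_integer_iff, (mem_unitSubmonoid_iff_valuation_eq_one L x).mp hx]

/-- An element of `O^×_L`, viewed in `𝒪_L`, is a unit there. [cite: MochizukiFrdII2008, Def 2.2 (iii) p.18] -/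
theorem isUnit_integer_of_mem_unitSubmonoid {x : L} (hx : x ∈ unitSubmonoid K L) :
    letI := FiniteExtension.valuativeRel K L
    IsUnit (⟨x, mem_integer_of_mem_unitSubmonoid L hx⟩ : 𝒪[L]) := by
  letI := FiniteExtension.valuativeRel K L
  rw [(Valuation.integer.integers (valuation L)).isUnit_iff_valuation_eq_one]
  exact (mem_unitSubmonoid_iff_valuation_eq_one L x).mp hx

/-- A unit of `𝒪_L` lies in `O^×_L`. [cite: MochizukiFrdII2008, Def 2.2 (iii) p.18] -/
theorem coe_mem_unitSubmonoid_of_isUnit :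
    letI := FiniteExtension.valuativeRel K L
    ∀ {y : 𝒪[L]}, IsUnit y → (y : L) ∈ unitSubmonoid K L := by
  letI := FiniteExtension.valuativeRel K L
  intro y hy
  rw [mem_unitSubmonoid_iff_valuation_eq_one]
  exact ((Valuation.integer.integers (valuation L)).isUnit_iff_valuation_eq_one).mp hy

/-! ### `u ↦ u^ℓ` is a bijection of `O^×_L` -/

namespace GalMonoid

/-- Transport: if `u ↦ u^ℓ` is a bijection of the unit group `𝒪_L^×` of the prolonged valuation, it
is a bijection of the monoid `O^×_L` of the arithmetic context. [cite: MochizukiFrdII2008, Rmk 2.4.2 p.22] -/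
theorem pow_bijective_of_units_pow_bijective (ℓ : ℕ)
    (hbij : letI := FiniteExtension.valuativeRel K L;
      Function.Bijective fun u : (𝒪[L])ˣ => u ^ ℓ) :
    Function.Bijective fun x : GalMonoid (unitsStableSubmonoid K L) => x ^ ℓ := by
  letI := FiniteExtension.valuativeRel K L
  -- the unit of `𝒪[L]` attached to an element of `O^×_L`
  have hmem : ∀ x : GalMonoid (unitsStableSubmonoid K L), x.val ∈ unitSubmonoid K L :=
    fun x => x.val_mem
  refine ⟨fun x y hxy => ?_, fun x => ?_⟩
  · -- injectivity
    have hxy' : x ^ ℓ = y ^ ℓ := hxy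
    have hux := isUnit_integer_of_mem_unitSubmonoid L (hmem x)
    have huy := isUnit_integer_of_mem_unitSubmonoid L (hmem y)
    have hpow : hux.unit ^ ℓ = huy.unit ^ ℓ := by
      refine Units.ext (Subtype.ext ?_)
      rw [Units.val_pow_eq_pow_val, Units.val_pow_eq_pow_val, IsUnit.unit_spec, IsUnit.unit_spec]
      change x.val ^ ℓ = y.val ^ ℓ
      rw [← val_pow, ← val_pow, hxy']
    have h := hbij.1 hpow
    have h' := congrArg (fun u : (𝒪[L])ˣ => ((u : 𝒪[L]) : L)) h
    simp only [IsUnit.unit_spec] at h'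
    exact ext h'
  · -- surjectivity
    have hux := isUnit_integer_of_mem_unitSubmonoid L (hmem x)
    obtain ⟨w, hw⟩ := hbij.2 hux.unit
    have hw' : ((w : 𝒪[L]) : L) ^ ℓ = x.val := by
      have := congrArg (fun u : (𝒪[L])ˣ => ((u : 𝒪[L]) : L)) hw
      simpa only [Units.val_pow_eq_pow_val, IsUnit.unit_spec, SubmonoidClass.coe_pow] using this
    refine ⟨mk (w : 𝒪[L]) (coe_mem_unitSubmonoid_of_isUnit L w.isUnit), ext ?_⟩
    change (mk ((w : 𝒪[L]) : L) _ ^ ℓ).val = x.val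
    rw [val_pow, val_mk, hw']

/-- For every `N ≥ 1` and unit class `a mod N` there is a prime `ℓ ≡ a (mod N)` such that `u ↦ u^ℓ`
is a bijection of `O^×_L` (primes `ℓ > #𝓀_L` by Dirichlet; Neukirch *ANT* II (5.7)).
[cite: MochizukiFrdII2008, Rmk 2.4.2 p.22] -/
theorem exists_prime_pow_bijective_and_natCast_eq (N : ℕ) [NeZero N] {a : ZMod N}
    (ha : IsUnit a) :
    ∃ ℓ : ℕ, ℓ.Prime ∧
      Function.Bijective (fun x : GalMonoid (unitsStableSubmonoid K L) => x ^ ℓ) ∧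
        (ℓ : ZMod N) = a := by
  letI := FiniteExtension.valuativeRel K L
  letI := FiniteExtension.topologicalSpace K L
  haveI := FiniteExtension.isNonarchimedeanLocalField K L
  obtain ⟨ℓ, hℓ, -, hbij, hℓa⟩ := exists_prime_pow_units_bijective_and_natCast_eq (K := L) N ha
  exact ⟨ℓ, hℓ, pow_bijective_of_units_pow_bijective L ℓ hbij, hℓa⟩

end GalMonoid

/-! ### Remark 2.4.2 at the arithmetic context -/

namespace Def22Context

variable [Normal K L] (H : Subgroup (Field.absoluteGaloisGroup K)) [H.Normal]
  (hH : IsOpen (H : Set (Field.absoluteGaloisGroup K)))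

/-- **Remark 2.4.2, non-vacuously, at the arithmetic context** (FrdII p. 22): for `K` a
non-archimedean local field, `L ⊆ K̄` finite Galois, `H ⊆ G_K` open normal, the context
`ofLocalField L H hH O^×_L` (`Φ` absolutely primitive: `O^□ = O^×`) and `N > 2`: for EVERY additive
isomorphism `inv : F_N(A) ⥲ ℤ/Nℤ` there is an automorphism of the Definition 2.2 data, the identity
on `Aut_E(A_E)` (the `ℓ`-th power on `O^×_L` for a prime `ℓ ≡ −1 (mod N)` — the unit-wise Frobenius
shadow), whose constructed comparison data `F_N(A) ⥲ F_N(A)` are NOT compatible with `inv`.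
[cite: MochizukiFrdII2008, Rmk 2.4.2 p.22] -/
theorem rmk242_witness_ofLocalField (N : ℕ) (hN : 2 < N)
    (inv : FNInvariant (ofLocalField L H hH (unitsStableSubmonoid K L)) N) :
    ∃ e : Def22Context.Iso (ofLocalField L H hH (unitsStableSubmonoid K L))
        (ofLocalField L H hH (unitsStableSubmonoid K L)),
      (∀ τ, e.isoE τ = τ) ∧
        InvariantIncompatible _ _ N (e.thm24Data N) inv inv := by
  haveI : NeZero N := ⟨by omega⟩
  haveI : Fact (2 < N) := ⟨hN⟩
  obtain ⟨ℓ, -, hbij, hℓa⟩ :=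
    GalMonoid.exists_prime_pow_bijective_and_natCast_eq L N (a := -1) isUnit_one.neg
  have hne : ((ℓ : ℕ) : ZMod N) ≠ 1 := by
    rw [hℓa]
    exact ZMod.neg_one_ne_one
  obtain ⟨e, -, hE, hinc⟩ :=
    (ofLocalField L H hH (unitsStableSubmonoid K L)).rmk242_witness_invariantIncompatible N ℓ
      hbij hne inv
  exact ⟨e, hE, hinc⟩

/-- **Remark 2.4.2 ⇒ the conclusion of Theorem 2.4 (ii) FAILS at the arithmetic context with
`O^□ = O^×`** (FrdII p. 22: "it is no longer possible in general to conclude that the isomorphism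
… is compatible with the natural isomorphisms"): for `N > 2` and every `inv`, some `Ψ`-data
`T = e.thm24Data N` (an automorphism of the Definition 2.2 data, identity on `Aut_E(A_E)`) violate
`∀ x, inv (T.isoFN x) = inv x`; in particular `Thm24ii … fs fs T inv inv` forces `¬ fs`.
[cite: MochizukiFrdII2008, Rmk 2.4.2 p.22] -/
theorem rmk242_not_compatible_ofLocalField (N : ℕ) (hN : 2 < N)
    (inv : FNInvariant (ofLocalField L H hH (unitsStableSubmonoid K L)) N) :
    ∃ e : Def22Context.Iso (ofLocalField L H hH (unitsStableSubmonoid K L))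
        (ofLocalField L H hH (unitsStableSubmonoid K L)),
      (¬ ∀ x, inv.toAddEquiv ((e.thm24Data N).isoFN x) = inv.toAddEquiv x) ∧
        ∀ fs : Prop, Thm24ii _ _ N fs fs (e.thm24Data N) inv inv → ¬ fs := by
  obtain ⟨e, -, h⟩ := rmk242_witness_ofLocalField L H hH N hN inv
  exact ⟨e, not_thm24ii_conclusion_of_invariantIncompatible _ inv inv h,
    fun fs hii hfs => not_invariantIncompatible_of_thm24ii _ inv inv hii hfs hfs h⟩

end Def22Context

end PadicKummer

end Literature.AlgebraicGeometry.Frobenioids
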